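import Summits.FinalStateConjecture.FinalStateConjecture.Theses.EIHFluxBalance
import Summits.FinalStateConjecture.FinalStateConjecture.Theorems.EIHFluxBalanceInertialRecessionStubQuasiStationarityWeights

/-!
# Route EIHFluxBalance — `InertialRecession`, line `sublinear-is-free-clean-window-charges`,
# stub `stub_quasiStationarity`: REDUCTION TO WEIGHTED RATES

Final file of the kinematic reduction of the stub `stub_quasiStationarity` (K3′, "quasi-stationarity
of the modulated background at the weighted rate") of the crux `stmt-FinalStateConjecture-10166`.

* `weighted_fderiv_background_tendsto_zero` — the kinematic core with minimal hypotheses: for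
  `C¹` motions of bounded Lorentz factor, centres eventually in `‖ξᵢ(t)‖ ≤ κ²t`, eventually bounded
  drifts `ξ̇ᵢ`, and WEIGHTED RATES `t^{3/4}‖(Λᵢe₀)˙‖ → 0`, `aᵢ ≠ 0 → t^{3/4}‖(Λᵢe₃)˙‖ → 0`, the
  conclusion of the stub holds for every exclusion radius `ρ(t) → ∞`:
  `sup_{x⁰ = t, |x̲| ≤ κt, d ≥ ρ(t)} (1 + d^{7/4}) ‖∂₀G(λ(·))(x)‖ → 0`.
* `stub_quasiStationarity_of_weightedRates` — the stub's registered signature VERBATIM with ONE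
  extra hypothesis inserted after the third-order slaving block: the weighted rates. The bounded
  drift comes from the order-`0` translational slaving clause (`‖ξ̇ − v(Λ)‖ → 0`, `‖v(Λ)‖ ≤ 1`).

WHY THE EXTRA HYPOTHESIS (numbers): the `Λ̇`-channel of `∂₀G` has kernel `M/d`
(`norm_fderiv_summand_basisVector_zero_le`), so at `d ≍ t` the weight `d^{7/4}` leaves
`M t^{3/4}‖Λ̇ mod stabiliser‖`, and third-order slaving only gives `‖(Λe₀)˙‖ → 0` without a rate;
the rate `o(t^{-3/4})` of the 4-velocities (and spin axes) is a DYNAMICAL input (EIH accelerations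
`∼ M/D²` with separations `D ≳ t^{2/3}` give `t^{-7/12} → 0`), to be derived from the antecedent
elsewhere. The rates are stated on the columns `Λᵢe₀`, `Λᵢe₃` — invariant under repainting by the
Kerr–Schild stabiliser — not on `deriv Λᵢ` (cf. `kerrSchildPaintingRigidity_false_of_witness`).
-/

noncomputable section

namespace Summit.FinalStateConjecture.FinalStateConjecture.Theorems.SublinearIsFree.QuasiStationarity

open scoped BigOperators Topology ContDiff ENNReal Manifold
open Filter Set Function TopologicalSpace Literature.Geometry.Lorentzian
open Summit.FinalStateConjecture.FinalStateConjecture.Theorems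
open Summit.FinalStateConjecture.FinalStateConjecture.Theorems.InertialRecession.Negative

/-! ### Packaging: `iSup` over the slab region in `ℝ≥0∞` -/

/-- A family of suprema in `ℝ≥0∞` tends to `0` if every real level `ε > 0` is eventually an
upper bound of the family (`ENNReal.tendsto_nhds_zero`). [folklore] -/
theorem tendsto_biSup_zero_of_eventually {S : ℝ → Set E4} {f : ℝ → E4 → ℝ≥0∞}
    (h : ∀ ε : ℝ, 0 < ε → ∀ᶠ t in atTop, ∀ x ∈ S t, f t x ≤ ENNReal.ofReal ε) :
    Tendsto (fun t ↦ ⨆ x ∈ S t, f t x) atTop (𝓝 0) := by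
  rw [ENNReal.tendsto_nhds_zero]
  intro ε hε
  rcases eq_or_ne ε ⊤ with rfl | hne
  · exact Eventually.of_forall fun t ↦ le_top
  · have hε' : 0 < ε.toReal := ENNReal.toReal_pos hε.ne' hne
    filter_upwards [h ε.toReal hε'] with t ht
    refine iSup₂_le fun x hx ↦ (ht x hx).trans ?_
    rw [ENNReal.ofReal_toReal hne]

/-- `ofReal w · ‖V‖ₑ = ofReal (w ‖V‖)` for `w ≥ 0` (the stub's weighted `ℝ≥0∞` expression as the
image of a real product). [folklore] -/
theorem ofReal_mul_enorm {F : Type*} [SeminormedAddCommGroup F] {w : ℝ} (hw : 0 ≤ w) (V : F) :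
    ENNReal.ofReal w * ‖V‖ₑ = ENNReal.ofReal (w * ‖V‖) := by
  rw [ENNReal.ofReal_mul hw, ofReal_norm]

/-! ### The background field: `∂₀` of the sum is the sum of the `∂₀` -/

-- operator-norm instance paths on form-valued maps are slow to unify
set_option synthInstance.maxHeartbeats 200000 in
/-- **Time-line derivative of a differentiable field of forms**: for `Φ` differentiable at `x`,
`s ↦ Φ(x + (s − t)e₀)(v, w)` has derivative `DΦ(x)[e₀](v, w)` at `s = t` (evaluation at `(v, w)`
commutes with `D`; the line has velocity `e₀`). Scalar-valued, so that sums over holes are sums of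
real functions. [folklore] -/
theorem hasDerivAt_timeLine_apply {Φ : E4 → E4 →L[ℝ] E4 →L[ℝ] ℝ} {x : E4} (t : ℝ)
    (hΦ : DifferentiableAt ℝ Φ x) (v w : E4) :
    HasDerivAt (fun s : ℝ ↦ Φ (x + (s - t) • E4.basisVector 0) v w)
      (fderiv ℝ Φ x (E4.basisVector 0) v w) t := by
  have h1 := hΦ.hasFDerivAt.clm_apply (hasFDerivAt_const v x)
  have h2 := h1.clm_apply (hasFDerivAt_const w x)
  have hline : HasDerivAt (fun s : ℝ ↦ x + (s - t) • E4.basisVector 0) (E4.basisVector 0) t := by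
    have h := (((hasDerivAt_id t).sub_const t).smul_const (E4.basisVector 0)).const_add x
    simpa using h
  have hcomp := HasFDerivAt.comp_hasDerivAt_of_eq (l := fun y ↦ Φ y v w)
      (f := fun s : ℝ ↦ x + (s - t) • E4.basisVector 0) t h2 hline (by simp)
  have hval : ((Φ x v).comp (0 : E4 →L[ℝ] E4) +
      ((Φ x).comp (0 : E4 →L[ℝ] E4) + (fderiv ℝ Φ x).flip v).flip w) (E4.basisVector 0) =
      fderiv ℝ Φ x (E4.basisVector 0) v w := by simp
  rw [hval] at hcomp
  exact hcomp

-- operator-norm instance paths on form-valued maps are slow to unify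
set_option synthInstance.maxHeartbeats 200000 in
/-- A finite sum of form-valued maps differentiable at `x` is differentiable at `x` (binary
induction; Mathlib's `DifferentiableAt.fun_sum` does not unify on spaces of bilinear forms).
[folklore] -/
theorem differentiableAt_finset_sum_forms {ι : Type*} (u : Finset ι)
    {S : ι → E4 → E4 →L[ℝ] E4 →L[ℝ] ℝ} {x : E4} (h : ∀ i ∈ u, DifferentiableAt ℝ (S i) x) :
    DifferentiableAt ℝ (fun y ↦ ∑ i ∈ u, S i y) x := by
  classical
  induction u using Finset.induction_on with
  | empty =>
    simp only [Finset.sum_empty]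
    exact differentiableAt_const _
  | insert j u hj ih =>
    have hfun : (fun y ↦ ∑ i ∈ insert j u, S i y) = fun y ↦ S j y + ∑ i ∈ u, S i y := by
      funext y
      rw [Finset.sum_insert hj]
    rw [hfun]
    exact DifferentiableAt.add (𝕜 := ℝ) (E := E4) (F := E4 →L[ℝ] E4 →L[ℝ] ℝ)
      (h j (Finset.mem_insert_self _ _)) (ih fun i hi ↦ h i (Finset.mem_insert_of_mem hi))

-- operator-norm instance paths on form-valued maps are slow to unify
set_option synthInstance.maxHeartbeats 200000 in
/-- `D(η + Σᵢ Sᵢ)(x)[e₀](v, w) = Σᵢ DSᵢ(x)[e₀](v, w)` when every summand is differentiable at `x`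
(time-line derivatives of real functions add up). [folklore] -/
theorem fderiv_background_basisVector_zero_apply {N : ℕ} {M a : Fin N → ℝ}
    {Λ : Fin N → ℝ → lorentzGroup} {ξ : Fin N → ℝ → E3} {x : E4}
    (h : ∀ i, DifferentiableAt ℝ (fun y : E4 ↦ boostedKerrBilin (Λ i (y 0))
      (E4.ofTimeSpace (y 0) (ξ i (y 0))) (M i) (a i) y - Minkowski.bilin) x) (v w : E4) :
    fderiv ℝ (fun y : E4 ↦ Minkowski.bilin + ∑ i, (boostedKerrBilin (Λ i (y 0))
        (E4.ofTimeSpace (y 0) (ξ i (y 0))) (M i) (a i) y - Minkowski.bilin)) x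
        (E4.basisVector 0) v w =
      ∑ i, fderiv ℝ (fun y : E4 ↦ boostedKerrBilin (Λ i (y 0))
        (E4.ofTimeSpace (y 0) (ξ i (y 0))) (M i) (a i) y - Minkowski.bilin) x
        (E4.basisVector 0) v w := by
  have hF : DifferentiableAt ℝ (fun y : E4 ↦ Minkowski.bilin + ∑ i, (boostedKerrBilin (Λ i (y 0))
      (E4.ofTimeSpace (y 0) (ξ i (y 0))) (M i) (a i) y - Minkowski.bilin)) x :=
    DifferentiableAt.const_add (𝕜 := ℝ) (E := E4) (F := E4 →L[ℝ] E4 →L[ℝ] ℝ) Minkowski.bilin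
      (differentiableAt_finset_sum_forms Finset.univ
        (S := fun i (y : E4) ↦ boostedKerrBilin (Λ i (y 0)) (E4.ofTimeSpace (y 0) (ξ i (y 0))) (M i)
          (a i) y - Minkowski.bilin) fun i _ ↦ h i)
  have hT := hasDerivAt_timeLine_apply (x 0) hF v w
  have hTi := fun i ↦ hasDerivAt_timeLine_apply (x 0) (h i) v w
  have hsum := (HasDerivAt.fun_sum (u := Finset.univ) fun i _ ↦ hTi i).const_add
    (Minkowski.bilin v w)
  have hfun : (fun s : ℝ ↦ (Minkowski.bilin + ∑ i, (boostedKerrBilin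
      (Λ i ((x + (s - x 0) • E4.basisVector 0) 0))
      (E4.ofTimeSpace ((x + (s - x 0) • E4.basisVector 0) 0)
        (ξ i ((x + (s - x 0) • E4.basisVector 0) 0))) (M i) (a i)
      (x + (s - x 0) • E4.basisVector 0) - Minkowski.bilin)) v w) =
      fun s : ℝ ↦ Minkowski.bilin v w + ∑ i ∈ Finset.univ, (boostedKerrBilin
        (Λ i ((x + (s - x 0) • E4.basisVector 0) 0))
        (E4.ofTimeSpace ((x + (s - x 0) • E4.basisVector 0) 0)
          (ξ i ((x + (s - x 0) • E4.basisVector 0) 0))) (M i) (a i)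
        (x + (s - x 0) • E4.basisVector 0) - Minkowski.bilin) v w := by
    funext s
    simp only [add_apply, _root_.sum_apply]
  rw [hfun] at hT
  exact hT.unique hsum

-- operator-norm instance paths on form-valued maps are slow to unify
set_option synthInstance.maxHeartbeats 200000 in
/-- `‖D(η + Σᵢ Sᵢ)(x)[e₀]‖ ≤ Σᵢ ‖DSᵢ(x)[e₀]‖` when every summand is differentiable at `x`.
[folklore] -/
theorem norm_fderiv_background_basisVector_zero_le {N : ℕ} {M a : Fin N → ℝ}
    {Λ : Fin N → ℝ → lorentzGroup} {ξ : Fin N → ℝ → E3} {x : E4}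
    (h : ∀ i, DifferentiableAt ℝ (fun y : E4 ↦ boostedKerrBilin (Λ i (y 0))
      (E4.ofTimeSpace (y 0) (ξ i (y 0))) (M i) (a i) y - Minkowski.bilin) x) :
    ‖fderiv ℝ (fun y : E4 ↦ Minkowski.bilin + ∑ i, (boostedKerrBilin (Λ i (y 0))
        (E4.ofTimeSpace (y 0) (ξ i (y 0))) (M i) (a i) y - Minkowski.bilin)) x
        (E4.basisVector 0)‖ ≤
      ∑ i, ‖fderiv ℝ (fun y : E4 ↦ boostedKerrBilin (Λ i (y 0))
        (E4.ofTimeSpace (y 0) (ξ i (y 0))) (M i) (a i) y - Minkowski.bilin) x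
        (E4.basisVector 0)‖ := by
  refine ContinuousLinearMap.opNorm_le_bound₂ _ (Finset.sum_nonneg fun i _ ↦ norm_nonneg
    (fderiv ℝ (fun y : E4 ↦ boostedKerrBilin (Λ i (y 0)) (E4.ofTimeSpace (y 0) (ξ i (y 0)))
      (M i) (a i) y - Minkowski.bilin) x (E4.basisVector 0))) fun v w ↦ ?_
  rw [fderiv_background_basisVector_zero_apply h v w, Finset.sum_mul, Finset.sum_mul]
  refine (norm_sum_le _ _).trans (Finset.sum_le_sum fun i _ ↦ ?_)
  exact (fderiv ℝ (fun y : E4 ↦ boostedKerrBilin (Λ i (y 0)) (E4.ofTimeSpace (y 0) (ξ i (y 0)))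
    (M i) (a i) y - Minkowski.bilin) x (E4.basisVector 0)).le_opNorm₂ v w

/-! ### Elementary facts used by the assembly -/

/-- The weight is monotone in the distance: `d ≤ d'`, `0 ≤ d` give
`√(√(d⁷)) ≤ √(√(d'⁷))`. [folklore] -/
theorem weight_mono {d d' : ℝ} (hd : 0 ≤ d) (h : d ≤ d') : √(√(d ^ 7)) ≤ √(√(d' ^ 7)) :=
  Real.sqrt_le_sqrt (Real.sqrt_le_sqrt (pow_le_pow_left₀ hd h 7))

/-- **The painted velocity is subluminal**: `‖((Λe₀)⁰)⁻¹ (Λe₀)~‖ ≤ 1` for `Λ ∈ O(1,3)`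
(`((Λe₀)⁰)² = 1 + ‖(Λe₀)~‖²`). [folklore] -/
theorem norm_painted_velocity_le_one (Λ : lorentzGroup) :
    ‖((((Λ : E4 ≃L[ℝ] E4) (E4.basisVector 0)) 0)⁻¹ •
      E4.spatial ((Λ : E4 ≃L[ℝ] E4) (E4.basisVector 0)))‖ ≤ 1 := by
  set u := (Λ : E4 ≃L[ℝ] E4) (E4.basisVector 0) with hu
  have hsq := lorentz_apply_zero_sq Λ
  have h1 := one_le_abs_lorentz_apply_zero Λ
  rw [← hu] at hsq h1
  have hpos : 0 < |u 0| := one_pos.trans_le h1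
  have hsp : E4.spatialNorm u ≤ |u 0| := by
    refine (sq_le_sq₀ (E4.spatialNorm_nonneg u) (abs_nonneg _)).mp ?_
    rw [sq_abs]; linarith
  rw [norm_smul, norm_inv, Real.norm_eq_abs]
  rw [inv_mul_le_iff₀ hpos, mul_one]
  exact hsp

/-- Combining the two weighted rates of a hole into the single rate used by
`eventually_weighted_fderiv_summand_le`. [folklore] -/
theorem tendsto_combined_rate {a : ℝ} {f g : ℝ → ℝ}
    (hf : Tendsto (fun t : ℝ ↦ t ^ (3 / 4 : ℝ) * f t) atTop (𝓝 0))
    (hg : a ≠ 0 → Tendsto (fun t : ℝ ↦ t ^ (3 / 4 : ℝ) * g t) atTop (𝓝 0)) :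
    Tendsto (fun t : ℝ ↦ t ^ (3 / 4 : ℝ) * (f t + if a = 0 then 0 else g t)) atTop (𝓝 0) := by
  by_cases ha : a = 0
  · simp only [ha, if_true, add_zero]; exact hf
  · simp only [ha, if_false]
    have h := hf.add (hg ha)
    rw [add_zero] at h
    refine h.congr fun t ↦ ?_
    ring

/-! ### The kinematic core -/

-- operator-norm instance paths on form-valued maps are slow to unify
set_option synthInstance.maxHeartbeats 200000 in
/-- **Eventual weighted estimate for the whole background field** (real-valued form of
`weighted_fderiv_background_tendsto_zero`): under its hypotheses, for every `ε > 0`, eventually in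
`t`, `(1 + √(√(d⁷))) ‖D G(x)[e₀]‖ ≤ ε` for all slab points `x` in the cone with
`d = minᵢ ‖x̲ − ξᵢ(t)‖ ≥ ρ(t)` (sum of the per-hole estimates with budget `ε/(N+1)`, the weight being
monotone in the distance). [folklore] -/
theorem eventually_weighted_fderiv_background_le (N : ℕ) (M a : Fin N → ℝ)
    (Λ : Fin N → ℝ → lorentzGroup) (ξ : Fin N → ℝ → E3) (γ κ : ℝ)
    (hγ : ∀ i t, |((Λ i t : E4 ≃L[ℝ] E4) (E4.basisVector 0)) 0| ≤ γ)
    (hsmooth : ∀ i, ContDiff ℝ 1 (ξ i) ∧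
      ContDiff ℝ 1 (fun t ↦ ((Λ i t : E4 ≃L[ℝ] E4) : E4 →L[ℝ] E4)))
    (hκ : 0 ≤ κ ∧ κ ≤ 1 ∧ ∀ i, ∀ᶠ t in atTop, ‖ξ i t‖ ≤ κ ^ 2 * t)
    (hV : ∀ i, ∃ V : ℝ, ∀ᶠ t in atTop, ‖deriv (ξ i) t‖ ≤ V)
    (hrate : ∀ i : Fin N, Tendsto (fun t : ℝ ↦ t ^ (3 / 4 : ℝ) *
        ‖deriv (fun s ↦ (((Λ i s : lorentzGroup) : E4 ≃L[ℝ] E4) (E4.basisVector 0))) t‖)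
        atTop (𝓝 0) ∧
      (a i ≠ 0 → Tendsto (fun t : ℝ ↦ t ^ (3 / 4 : ℝ) *
        ‖deriv (fun s ↦ (((Λ i s : lorentzGroup) : E4 ≃L[ℝ] E4) (E4.basisVector 3))) t‖)
        atTop (𝓝 0)))
    {ρ : ℝ → ℝ} (hρ : Tendsto ρ atTop atTop) {ε : ℝ} (hε : 0 < ε) :
    ∀ᶠ t in atTop, ∀ x : E4, x 0 = t → E4.spatialNorm x ≤ κ * t →
      ρ t ≤ (⨅ i, ‖E4.spatial x - ξ i t‖) →
      (1 + √(√((⨅ i, ‖E4.spatial x - ξ i t‖) ^ 7))) *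
        ‖fderiv ℝ (fun y : E4 ↦ Minkowski.bilin + ∑ i, (boostedKerrBilin (Λ i (y 0))
          (E4.ofTimeSpace (y 0) (ξ i (y 0))) (M i) (a i) y - Minkowski.bilin)) x
          (E4.basisVector 0)‖ ≤ ε := by
  -- per-hole budget
  have hδ : 0 < ε / (N + 1) := div_pos hε (by positivity)
  have hev : ∀ i, ∀ᶠ t in atTop, ∀ x : E4, x 0 = t → E4.spatialNorm x ≤ κ * t →
      ρ t ≤ ‖E4.spatial x - ξ i t‖ →
      (1 + √(√(‖E4.spatial x - ξ i t‖ ^ 7))) *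
        ‖fderiv ℝ (fun y : E4 ↦ boostedKerrBilin (Λ i (y 0)) (E4.ofTimeSpace (y 0) (ξ i (y 0)))
          (M i) (a i) y - Minkowski.bilin) x (E4.basisVector 0)‖ ≤ ε / (N + 1) := by
    intro i
    obtain ⟨V, hVi⟩ := hV i
    exact eventually_weighted_fderiv_summand_le (hsmooth i).2 (hsmooth i).1 (hγ i) hκ.1 hκ.2.1
      (hκ.2.2 i) hVi (tendsto_combined_rate (hrate i).1 (hrate i).2) hρ hδ
  have hfar : ∀ i, ∀ᶠ t in atTop, max 1 (2 * |a i|) ≤ ρ t := fun i ↦ hρ.eventually_ge_atTop _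
  filter_upwards [eventually_all.2 hev, eventually_all.2 hfar] with t ht htfar
  intro x hx0 hcone hρx
  -- every hole is far
  have hinf_le : ∀ i, (⨅ j, ‖E4.spatial x - ξ j t‖) ≤ ‖E4.spatial x - ξ i t‖ := fun i ↦
    ciInf_le ⟨0, by rintro _ ⟨j, rfl⟩; exact norm_nonneg _⟩ i
  have hinf0 : 0 ≤ ⨅ j, ‖E4.spatial x - ξ j t‖ := Real.iInf_nonneg fun _ ↦ norm_nonneg _
  have hdi : ∀ i, max 1 (2 * |a i|) ≤ ‖E4.spatial x - ξ i t‖ := fun i ↦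
    (htfar i).trans (hρx.trans (hinf_le i))
  have hdiff := fun i ↦ (contDiffAt_summand (M := M i) (a := a i) (hsmooth i).2 (hsmooth i).1
    hx0 (hdi i)).differentiableAt one_ne_zero
  have hW0 : 0 ≤ 1 + √(√((⨅ i, ‖E4.spatial x - ξ i t‖) ^ 7)) := by positivity
  refine (mul_le_mul_of_nonneg_left (norm_fderiv_background_basisVector_zero_le hdiff) hW0).trans
    ?_
  rw [Finset.mul_sum]
  have hterm : ∀ i, (1 + √(√((⨅ i, ‖E4.spatial x - ξ i t‖) ^ 7))) *
      ‖fderiv ℝ (fun y : E4 ↦ boostedKerrBilin (Λ i (y 0))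
          (E4.ofTimeSpace (y 0) (ξ i (y 0))) (M i) (a i) y - Minkowski.bilin) x (E4.basisVector 0)‖ ≤
      ε / (N + 1) := fun i ↦ by
    have hWi : 1 + √(√((⨅ i, ‖E4.spatial x - ξ i t‖) ^ 7)) ≤
        1 + √(√(‖E4.spatial x - ξ i t‖ ^ 7)) :=
      add_le_add le_rfl (weight_mono hinf0 (hinf_le i))
    exact (mul_le_mul_of_nonneg_right hWi (norm_nonneg (fderiv ℝ (fun y : E4 ↦
      boostedKerrBilin (Λ i (y 0)) (E4.ofTimeSpace (y 0) (ξ i (y 0))) (M i) (a i) y -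
        Minkowski.bilin) x (E4.basisVector 0)))).trans
      (ht i x hx0 hcone (hρx.trans (hinf_le i)))
  refine (Finset.sum_le_sum fun i _ ↦ hterm i).trans ?_
  rw [Finset.sum_const, Finset.card_univ, Fintype.card_fin, nsmul_eq_mul, mul_div_assoc',
    div_le_iff₀ (by positivity)]
  nlinarith

/-- **Quasi-stationarity of the modulated background at the weighted rate, from weighted rates of
the moduli.** For `N` holes with `C¹` motions `Λᵢ` of Lorentz factor `≤ γ`, `C¹` centres `ξᵢ`
eventually in `‖ξᵢ(t)‖ ≤ κ²t` (`0 ≤ κ ≤ 1`), eventually bounded drifts `‖ξ̇ᵢ‖ ≤ Vᵢ` and WEIGHTED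
RATES `t^{3/4}‖(Λᵢe₀)˙‖ → 0`, `aᵢ ≠ 0 → t^{3/4}‖(Λᵢe₃)˙‖ → 0`: for every `ρ(t) → ∞`,
`sup {(1 + √(√(d⁷))) ‖D G(x)[e₀]‖ : x⁰ = t, |x̲| ≤ κt, d(x) = minᵢ‖x̲ − ξᵢ(t)‖ ≥ ρ(t)} → 0` for the
background field `G(y) = η + Σᵢ (boostedKerrBilin (Λᵢ(y⁰)) (y⁰, ξᵢ(y⁰)) Mᵢ aᵢ y − η)`. [folklore] -/
theorem weighted_fderiv_background_tendsto_zero (N : ℕ) (M a : Fin N → ℝ)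
    (Λ : Fin N → ℝ → lorentzGroup) (ξ : Fin N → ℝ → E3) (γ κ : ℝ)
    (hγ : ∀ i t, |((Λ i t : E4 ≃L[ℝ] E4) (E4.basisVector 0)) 0| ≤ γ)
    (hsmooth : ∀ i, ContDiff ℝ 1 (ξ i) ∧
      ContDiff ℝ 1 (fun t ↦ ((Λ i t : E4 ≃L[ℝ] E4) : E4 →L[ℝ] E4)))
    (hκ : 0 ≤ κ ∧ κ ≤ 1 ∧ ∀ i, ∀ᶠ t in atTop, ‖ξ i t‖ ≤ κ ^ 2 * t)
    (hV : ∀ i, ∃ V : ℝ, ∀ᶠ t in atTop, ‖deriv (ξ i) t‖ ≤ V)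
    (hrate : ∀ i : Fin N, Tendsto (fun t : ℝ ↦ t ^ (3 / 4 : ℝ) *
        ‖deriv (fun s ↦ (((Λ i s : lorentzGroup) : E4 ≃L[ℝ] E4) (E4.basisVector 0))) t‖)
        atTop (𝓝 0) ∧
      (a i ≠ 0 → Tendsto (fun t : ℝ ↦ t ^ (3 / 4 : ℝ) *
        ‖deriv (fun s ↦ (((Λ i s : lorentzGroup) : E4 ≃L[ℝ] E4) (E4.basisVector 3))) t‖)
        atTop (𝓝 0)))
    (ρ : ℝ → ℝ) (hρ : Tendsto ρ atTop atTop) :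
    Tendsto (fun t : ℝ ↦ ⨆ x ∈ {x : E4 | x 0 = t ∧ E4.spatialNorm x ≤ κ * t ∧
        ρ t ≤ ⨅ i, ‖E4.spatial x - ξ i t‖},
      ENNReal.ofReal (1 + √(√((⨅ i, ‖E4.spatial x - ξ i t‖) ^ 7))) *
        ‖fderiv ℝ (fun y : E4 ↦ Minkowski.bilin + ∑ i, (boostedKerrBilin (Λ i (y 0))
          (E4.ofTimeSpace (y 0) (ξ i (y 0))) (M i) (a i) y - Minkowski.bilin)) x
          (E4.basisVector 0)‖ₑ) atTop (𝓝 0) := by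
  refine tendsto_biSup_zero_of_eventually fun ε hε ↦ ?_
  filter_upwards [eventually_weighted_fderiv_background_le N M a Λ ξ γ κ hγ hsmooth hκ hV hrate
    hρ hε] with t ht
  rintro x ⟨hx0, hcone, hρx⟩
  rw [ofReal_mul_enorm (by positivity)]
  exact ENNReal.ofReal_le_ofReal (ht x hx0 hcone hρx)

/-! ### The registered stub with the weighted rates as an explicit hypothesis -/

-- operator-norm instance paths on form-valued maps are slow to unify
set_option synthInstance.maxHeartbeats 200000 in
/-- **Stub `stub_quasiStationarity` of the line `sublinear-is-free-clean-window-charges`, REDUCED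
TO WEIGHTED RATES.** The registered signature verbatim (antecedent of the crux
`InertialRecession`, then the third-order slaving block), with ONE extra hypothesis inserted before
the conclusion: for every hole, `t^{3/4}‖(Λᵢe₀)˙(t)‖ → 0` and, if `aᵢ ≠ 0`,
`t^{3/4}‖(Λᵢe₃)˙(t)‖ → 0`. Conclusion: for every `ρ(t) → ∞`, quasi-stationarity of the modulated
background at the weighted rate `1 + d^{7/4}` on the lab slabs inside the cone `|x̲| ≤ κt` at
distance `≥ ρ(t)` from all painted centres. Only the Lorentz-factor, smoothness and cone clauses of
the antecedent and the order-`0` translational slaving clause (bounded drift) are used.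
[folklore] -/
theorem stub_quasiStationarity_of_weightedRates : ∀ (X : Type) [TopologicalSpace X] [ChartedSpace E3 X] [IsManifold (𝓡 3) ((⊤ : ℕ∞) : WithTop ℕ∞) X] [T2Space X] [SecondCountableTopology X] [ConnectedSpace X], ∀ D ∈ admissibleVacuumData X, ∀ 𝒟 : VacuumCauchyDevelopment D, 𝒟.IsMaximal → ∀ (N : ℕ) (M a rin : Fin N → ℝ) (Λ : Fin N → ℝ → lorentzGroup) (ξ : Fin N → ℝ → E3) (γ κ τ₀ : ℝ) (U : Opens E4) (Φ : U → 𝒟.carrier) (O : Set 𝒟.carrier), ((∀ i, Kerr.IsSubextremal (M i) (a i) ∧ Kerr.rMinus (M i) (a i) < rin i ∧ rin i < Kerr.rPlus (M i) (a i)) ∧ (∀ i t, |((Λ i t : E4 ≃L[ℝ] E4) (E4.basisVector 0)) 0| ≤ γ) ∧ (∀ i, ContDiff ℝ ((⊤ : ℕ∞) : WithTop ℕ∞) (ξ i) ∧ ContDiff ℝ ((⊤ : ℕ∞) : WithTop ℕ∞) (fun t ↦ ((Λ i t : E4 ≃L[ℝ] E4) : E4 →L[ℝ] E4))) ∧ (∀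 i j, i ≠ j → Tendsto (fun t ↦ ‖ξ i t - ξ j t‖) atTop atTop) ∧ (0 < κ ∧ κ < 1 ∧ ∀ i, ∀ᶠ t in atTop, ‖ξ i t‖ ≤ κ ^ 2 * t) ∧ ({x : E4 | τ₀ < x 0 ∧ ∀ i, rin i < Kerr.radius (a i) (poincareInv (Λ i (x 0)) (E4.ofTimeSpace (x 0) (ξ i (x 0))) x)} ⊆ (U : Set E4)) ∧ let B : ModelBackground := ⟨U, fun x ↦ Minkowski.bilin + ∑ i, (boostedKerrBilin (Λ i (x 0)) (E4.ofTimeSpace (x 0) (ξ i (x 0))) (M i) (a i) x - Minkowski.bilin), fun x ↦ x 0, E4.spatialNorm⟩; ContMDiff 𝓘(ℝ, E4) (𝓡 4) ((⊤ : ℕ∞) : WithTop ℕ∞) Φ ∧ Topology.IsOpenEmbedding ((B.lateRegion τ₀).restrict Φ) ∧ Φ '' {x : U | τ₀ < x.1 0 ∧ ∀ i, Kerr.rPlus (M i) (a i) < Kerr.radius (a i) (poincareInv (Λ i (x.1 0)) (E4.ofTimeSpace (x.1 0) (ξ i (x.1 0))) x.1)} ⊆ O ∧ Tendsto (fun t ↦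 𝒟.toSpacetime.deviationCk B Φ 3 t) atTop (𝓝 0) ∧ Tendsto (fun t : ℝ ↦ ⨆ x ∈ {x : U | x.1 0 = t ∧ E4.spatialNorm x.1 ≤ κ * t}, ⨆ (m : ℕ) (_ : m ≤ 3), ENNReal.ofReal (1 + √(√((⨅ i, ‖E4.spatial x.1 - ξ i t‖) ^ 7))) * ‖iteratedFDeriv ℝ m (𝒟.toSpacetime.deviationExtend B Φ) x.1‖ₑ) atTop (𝓝 0) ∧ O = Summit.FinalStateConjecture.exteriorOf 𝒟.toCauchyDevelopment (Φ '' {x : U | τ₀ < x.1 0 ∧ ∀ i, Kerr.rPlus (M i) (a i) < Kerr.radius (a i) (poincareInv (Λ i (x.1 0)) (E4.ofTimeSpace (x.1 0) (ξ i (x.1 0))) x.1)}) ∧ ∀ t₁ : ℝ, τ₀ < t₁ → O \ Φ '' {x : U | t₁ < x.1 0 ∧ ∀ i, Kerr.rPlus (M i) (a i) < Kerr.radius (a i) (poincareInv (Λ i (x.1 0)) (E4.ofTimeSpace (x.1 0) (ξ i (x.1 0))) x.1)} ⊆ 𝒟.metric.causalPast 𝒟.timeOrientation (Φ '' {x : U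 | x.1 0 = t₁ ∧ ∀ i, Kerr.rPlus (M i) (a i) < Kerr.radius (a i) (poincareInv (Λ i (x.1 0)) (E4.ofTimeSpace (x.1 0) (ξ i (x.1 0))) x.1)})) → (∀ i : Fin N, (∀ m : ℕ, 1 ≤ m → m ≤ 3 → Tendsto (fun t ↦ iteratedDeriv m (fun s ↦ (((Λ i s : lorentzGroup) : E4 ≃L[ℝ] E4) (E4.basisVector 0))) t) atTop (𝓝 0)) ∧ (∀ m : ℕ, m ≤ 2 → Tendsto (fun t ↦ iteratedDeriv m (fun s ↦ deriv (ξ i) s - (((((Λ i s : lorentzGroup) : E4 ≃L[ℝ] E4) (E4.basisVector 0)) 0)⁻¹ • E4.spatial (((Λ i s : lorentzGroup) : E4 ≃L[ℝ] E4) (E4.basisVector 0)))) t) atTop (𝓝 0)) ∧ (a i ≠ 0 → ∀ m : ℕ, 1 ≤ m → m ≤ 3 → Tendsto (fun t ↦ iteratedDeriv m (fun s ↦ (((Λ i s : lorentzGroup) : E4 ≃L[ℝ] E4) (E4.basisVector 3))) t) atTop (𝓝 0))) → (∀ i : Fin N, Tendsto (fun t : ℝ ↦ t ^ (3 / 4 :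 ℝ) * ‖deriv (fun s ↦ (((Λ i s : lorentzGroup) : E4 ≃L[ℝ] E4) (E4.basisVector 0))) t‖) atTop (𝓝 0) ∧ (a i ≠ 0 → Tendsto (fun t : ℝ ↦ t ^ (3 / 4 : ℝ) * ‖deriv (fun s ↦ (((Λ i s : lorentzGroup) : E4 ≃L[ℝ] E4) (E4.basisVector 3))) t‖) atTop (𝓝 0))) → (∀ ρ : ℝ → ℝ, Tendsto ρ atTop atTop → Tendsto (fun t : ℝ ↦ ⨆ x ∈ {x : E4 | x 0 = t ∧ E4.spatialNorm x ≤ κ * t ∧ ρ t ≤ ⨅ i, ‖E4.spatial x - ξ i t‖}, ENNReal.ofReal (1 + √(√((⨅ i, ‖E4.spatial x - ξ i t‖) ^ 7))) * ‖fderiv ℝ (fun y : E4 ↦ Minkowski.bilin + ∑ i, (boostedKerrBilin (Λ i (y 0)) (E4.ofTimeSpace (y 0) (ξ i (y 0))) (M i) (a i) y - Minkowski.bilin)) x (E4.basisVector 0)‖ₑ) atTop (𝓝 0)) := by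
  intro X _ _ _ _ _ _ D _hD 𝒟 _h𝒟 N M a rin Λ ξ γ κ τ₀ U Φ O hant hslaved hrates ρ hρ
  -- the kinematic clauses of the antecedent
  have hγ := hant.2.1
  have hsmooth := hant.2.2.1
  have hκ := hant.2.2.2.2.1
  refine weighted_fderiv_background_tendsto_zero N M a Λ ξ γ κ hγ
    (fun i ↦ ⟨(hsmooth i).1.of_le (by exact_mod_cast le_top),
      (hsmooth i).2.of_le (by exact_mod_cast le_top)⟩)
    ⟨hκ.1.le, hκ.2.1.le, hκ.2.2⟩ (fun i ↦ ⟨2, ?_⟩) hrates ρ hρ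
  -- bounded drift from third-order slaving (order `0` of the translational clause)
  have h0 := (hslaved i).2.1 0 (Nat.zero_le _)
  simp only [iteratedDeriv_zero] at h0
  have hev : ∀ᶠ t in atTop, ‖deriv (ξ i) t -
      ((((Λ i t : lorentzGroup) : E4 ≃L[ℝ] E4) (E4.basisVector 0)) 0)⁻¹ •
        E4.spatial (((Λ i t : lorentzGroup) : E4 ≃L[ℝ] E4) (E4.basisVector 0))‖ < 1 := by
    have h := (tendsto_iff_norm_sub_tendsto_zero.mp h0)
    simp only [sub_zero] at h
    exact h.eventually (gt_mem_nhds one_pos)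
  filter_upwards [hev] with t ht
  have hvel := norm_painted_velocity_le_one (Λ i t)
  have htri := norm_sub_norm_le (deriv (ξ i) t)
    (((((Λ i t : lorentzGroup) : E4 ≃L[ℝ] E4) (E4.basisVector 0)) 0)⁻¹ •
      E4.spatial (((Λ i t : lorentzGroup) : E4 ≃L[ℝ] E4) (E4.basisVector 0)))
  linarith

end Summit.FinalStateConjecture.FinalStateConjecture.Theorems.SublinearIsFree.QuasiStationarity

end
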